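import Mathlib
import HarnessLib
import HarnessLib.Audit
import Summits.QuantumAdvantage.Statement
import Literature.Computability.Cryptography.ClassBQP
import Literature.Computability.Complexity.Randomized
import Literature.Computability.Complexity.BPPErrorReduction
import Literature.Computability.Complexity.BoolEncodings
import HarnessLib.Audit.Status.Attr

/-!
Route: HankelLift

# Route HankelLift — give each party a summand — additive lifting makes threshold and communication
rungs of the Liouville witness provable

It suffices to show X = X_D ∧ X_G ∧ X_M ∧ X_H for the LIFTED Liouville witness L⁺ = {⟨x,y⟩ :
λ(x+y+2) = −1} (x, y n-bit): X_D (HankelDiscrepancy,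
THEOREM-target) every combinatorial rectangle S×T ⊆ [2^n]² has |Σ_{S×T} λ(x+y+2)| ≤ 4^n·n^{−C},
because giving each party a SUMMAND (not a digit
block) turns the 2-party discrepancy of the witness into Davenport's uniform minor/major-arc bound
via Parseval on the Hankel symbol; X_G (DiscToRules,
provable glue) hence every product-partition prediction rule with ≤ n² labels a side agrees with
λ(x+y+2) on ≤ 51 % of pairs; X_M (LiouvilleSumMemBQP)
L⁺ ∈ BQP (Shor ⇒ λ, landed as MobiusLadder.LiouvilleMemBQP, composed with (x,y) ↦ x+y+2); X_H
(BeyondRectangles, hypothesis-type, ranked last)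
no probabilistic polynomial-time predictor beats the best such rectangle rule by 1/10 on uniformly
random n-bit pairs for infinitely many n. Operator C
(barrier inversion): NaturalProofs + the BC9 ceilings of every ladder say new rungs must live above
AC⁰[p] yet below the PRF frontier — depth-2
threshold / communication classes, whose only lower-bound currency is rectangle discrepancy and
sign-rank; a one-input arithmetic witness has no
2-party structure except digit splits (the dead middle band of DigitRung); re-encode the witness so
the split is arithmetically natural: x + y.
Lean: `LiouvilleSumMemBQP ∧ HankelDiscrepancy ∧ DiscToRules ∧ BeyondRectangles`

## Assembly
Pure logic plus the band pattern (sorry-free in Sketch.lean and glue.lean): LiouvilleSumMemBQP puts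
L⁺ in BQP; if L⁺ were in BPP, error reduction
(exists_randAlg_error_le_of_mem_BPP_holds at 1/200) gives a PPT with average agreement ≥ 0.995 at
every n; BeyondRectangles gives, beyond the threshold of
DiscToRules(HankelDiscrepancy), an n and a rectangle rule within 1/10 of it, but that rule agrees ≤
0.51 — contradiction; hence L⁺ ∉ BPP and
⟨L⁺, ·, ·⟩ is the summit. Deciding theorem `closes (h₁ : LiouvilleSumMemBQP) (h₂ :
HankelDiscrepancy) (h₃ : DiscToRules) (h₄ : BeyondRectangles) :
QuantumAdvantage`, all four binders consumed.

Rationale: WHY THIS LINE. The move is the Babai–Nisan–Szegedy "character of a sum" lift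
(doi:10.1016/0022-0000(92)90047-M, there for the EASY quadratic character via Weil)
pointed at a Shor witness: for F_n(x,y) = λ(x+y+2) the rectangle sums are Σ_m λ(m+2)(1_S∗1_T)(m), so
Parseval and Cauchy–Schwarz bound them by
sup_θ|Σ_{m<2^{n+1}} λ(m+2)e(mθ)|·2^n, and Davenport's theorem (minor arcs = Green2012 Prop. 4, in
tree as
`Literature.NumberTheory.LFunctions.liouville_minorArc`; major arcs = `SiegelWalfiszMoebius_holds` +
partial summation) gives the saving n^{−C}.
Imported areas: analytic number theory of μ/λ twisted by additive characters (Davenport1937,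
MontgomeryVaughan2007 §13, Green2012 arXiv:1103.4991),
communication complexity / discrepancy / sign-rank (HMPST doi:10.1016/0022-0000(93)90001-D, Forster
doi:10.1016/S0022-0000(02)00019-3,
Viola–Wigderson doi:10.4086/toc.2008.v004a007, Chazelle2000), and the hub's own BQP/BPP
infrastructure (exists_randAlg_error_le_of_mem_BPP_holds).
What no route does: MobiusLadder (nearest) reads λ(N) from DIGITS and its TC⁰-direction crux
LiouvilleOrthogonalTC0 (stmt-QuantumAdvantage-1393) is
open and breakthrough-type; TwoSquaresLadder / ArithStatLadder / WeilTwice have AC⁰/AC⁰[p] rungs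
only; RectangleFree uses communication complexity on
the ¬S side for a different object (the exponentiation graph). Here the first
non-parity/majority-witnessed rungs for a Shor witness (rectangle
rules now; sign-rank ≥ n^{ω(1)}, THR∘MAJ and MAJ∘MAJ superpolynomial, BPP^cc = ω(log n) as layer-2
children) become theorems, and the deciding theorem
USES the rung: the hypothesis is typed RELATIVE to the rectangle-rule baseline (the
WeilTwice/SelmerBand band pattern), so X_D and X_G are load-bearing.

RANKED CRUXES. #2 HankelDiscrepancy (crux) — for every C, for all large n, every pair of sets S, T ⊆
[0,2^n) has |Σ_{x∈S} Σ_{y∈T} λ(x+y+2)| ≤ 4^n / n^C (rectangle discrepancy of the Liouville Hankel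
pattern; Davenport uniform exponential-sum bound + Parseval). [difficulty: L] (why it might fail:
Not in truth (Davenport for λ is a theorem); as a project: the major arcs need Siegel–Walfisz for λ
twisted by e(a m/q) for ALL q ≤ (log N)^{50(C+4)} (tree has μ in APs; λ via λ = 1_□ ∗ μ) and the
Green Prop. 4 exponent 50 forces large log-powers — L-sized bookkeeping.) [Davenport1937,
MontgomeryVaughan2007, arXiv:1103.4991, doi:10.1016/0022-0000(92)90047-M]
#3 BeyondRectangles (crux) — (hypothesis-type, never staffed for proof) for every probabilistic
polynomial-time algorithm A and infinitely many n there is a product-partition rule (a, b : [2^n] →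
[k], g : [k]² → {0,1}, k ≤ n²) such that A's average probability of outputting [λ(x+y+2) = −1]
correctly over uniform (x,y) ∈ [2^n]² is at most the rule's agreement fraction plus 1/10. [deps:
HankelDiscrepancy] [difficulty: open-problem] (why it might fail: Fails iff some PPT agrees with
λ(x+y+2) on ≥ 0.6 of uniform n-bit pairs for all large n (a 0.2-correlating feasible statistic;
fully factorable inputs have density O((log n)²/n), smooth-part tests correlate ≪ e^{−c√n});
average-case, so stronger than worst-case λ ∉ BPP.) [Sarnak2010, Kalai2011, AroraBarak2009,
arXiv:1103.4991]
#9 DiscToRules (support) — HankelDiscrepancy implies: for all large n, every product-partition rule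
with k ≤ n² labels a side agrees with [λ(x+y+2) = −1] on at most a 1/2 + 1/100 fraction of [2^n]²
(sum the k² cell discrepancies with C = 5). [difficulty: provable-now] [Chazelle2000,
doi:10.1016/0022-0000(93)90001-D, KushilevitzNisan1997]
#9 LiouvilleSumMemBQP (support) — the lifted pair-language {boolPair(bits_n x, bits_n y) : x, y <
2^n, λ(x+y+2) = −1} is in BQP (MobiusLadder.LiouvilleMemBQP, landed as
Theorems/MobiusLadderLiouvilleMemBQP.lean, composed with the linear-time map (x,y) ↦ x+y+2 and BQP's
closure under polynomial-time many-one maps). [difficulty: M] [Shor1997, BernsteinVazirani1997,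
arXiv:1103.4991]

TWO-LAYER PLAN. HankelDiscrepancy ⇐ UniformDavenport (sup_θ |Σ_{m<2^{n+1}} λ(m+2)e(mθ)| ≤ 2^n/n^C:
minor arcs from liouville_minorArc, major arcs from SiegelWalfiszMoebius_holds)
→ RectangleParseval (uniform symbol bound B ⇒ every rectangle sum ≤ B·2^n) → HankelDiscrepancy (k =
2; this is the registered birth skeleton).
Once HankelDiscrepancy closes, the UNBOUNDED-ERROR rungs are filed as its siblings: HankelSignRank
(every real matrix sign-representing λ(x+y+2) on
[2^n]² has rank ≥ n^C for every C: Toeplitz/Hankel operator norm ≤ sup of the symbol, then Forster's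
N/‖M‖), ThrMajRung (no THR∘MAJ circuit of
polynomial size and polynomial bottom weights computes λ(x+y+2): sign-rank ≤ s(2nW+1)+1 for such
circuits, Forster–Krause–Lokam–Mubarakzjanov–
Schmitt–Simon 2001), MajMajRung / BPP^cc = ω(log n) (HMPST discriminator lemma from
HankelDiscrepancy directly); and the k-party cylinder version for
λ(x₁+…+x_k) via Viola–Wigderson + the U^k-uniformity of λ (Leng–Sah–Sawhney quantitative inverse
theorem) as the depth-3 probe.

KILL CRITERIA. A PPT (or a P-computable statistic) agreeing with λ(x+y+2) on ≥ 0.6 of uniform n-bit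
pairs for all large n refutes BeyondRectangles: close
refuted:BeyondRectangles and hand the predictor to MobiusLadder (it refutes Möbius randomness
against P on average and very likely factors a positive
density of integers). HankelDiscrepancy cannot die (theorem in print); if its typing is refuted
(off-by-one at λ(0), λ(1)), restate once with the
shift. If MobiusLadder's LiouvilleNotPPoly is ever PROVED the hypothesis here is dominated (λ ∉
P/poly ⇒ worst-case) — close superseded. If
LiouvilleSumMemBQP fails to compose (encoding), re-type with encodeNat(x+y+2) inputs.

NOT DECOMPOSED YET. The major-arc bookkeeping constants (Green's exponent 50, the (log N)^{-A} form
rather than e^{-c√log N}, which would need Siegel–Walfisz for λ at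
moduli e^{c√log x} beyond the 2-power case landed as green_liouville_character_twoPower_holds); the
sign-rank / THR∘MAJ / k-party children named in the
two-layer plan; the relation between BeyondRectangles and MobiusLadder's worst-case apex
(average-case ⇒ worst-case only; no converse claimed).

CHEAPEST FALSIFIER. Numerics already run (local, pure python, 120 s): n = 5…12, N = 2^n:
sup_θ|Σ_{m<2N} λ(m+2)e(mθ)|/N = 0.506, 0.395, 0.291, 0.218, 0.167, 0.123, 0.087, 0.067
and the Hankel operator norm ‖H_n‖/N = 0.312, 0.247, 0.163, 0.116, 0.090, 0.070, 0.050, 0.044 —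
monotone decay ≈ N^{−0.4}, so disc(F_n) ≤ 0.044 and
Forster's bound already gives sign-rank ≥ 23 at n = 12; a refuter's cheapest kill of the HYPOTHESIS
is a smooth-part / small-prime-signature predictor
for λ(x+y+2) evaluated on 10⁶ random 64-bit pairs (expected agreement 1/2 + O(e^{−c√n}); anything ≥
0.55 would be alarming).

NUMBERS. Rectangle-rule ceiling used by closes: 1/2 + 1/100 (needs n ≥ 50 at C = 5, k ≤ n²);
hypothesis margin 1/10; error reduction to 1/200. Davenport:
sup_θ|Σ_{n≤N} μ(n)e(nθ)| ≪_A N(log N)^{−A} (MontgomeryVaughan2007 Thm 13.10-type; e^{−c√log N} with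
Siegel–Walfisz); Green2012 Prop. 4: q ≤ (C log⁴N/δ)^{50}.
Forster: sign-rank(M) ≥ N/‖M‖₂; HMPST: MAJ∘MAJ of size s ⇒ some bottom gate has correlation ≥
1/(s+1); known explicit THR∘THR bounds only n^{1.5}
(Kane–Williams arXiv:1511.07860) — the ceiling of this ladder's method family.

DEFINITION REQUESTS. None at birth: rectangle rules, averages and the pair encoding are inlined over
Finset / RandAlg.pr / boolPair. Later children will want
`signRank` (inline via Matrix.rank over sign patterns) and a depth-2 threshold-circuit predicate
(inline finite sums); Forster 2002 and the
FKLMSS 2001 rank lemma as Literature facts (cite items) when ThrMajRung is filed.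

Novelty: Searches (2026-08-17): corpus fts «"communication complexity" Möbius multiplicative» (1 hit:
Lovász–Saks 1988 lattice Möbius, unrelated); hybrid «communication complexity
Möbius Liouville x+y discrepancy Hankel sign-rank» (textbook hits only: Jukna2012 pp.114–134,
Chazelle2000 p.275); zbmath/crossref «Mobius function sumsets», «Liouville function
sumset discrepancy», «multiplicative functions communication complexity», «sign rank Toeplitz
matrix», «threshold circuits integer multiplication Möbius lower bound» (nothing
relevant); arxiv «sign-rank Hankel matrix lower bound spectral norm» (0); lit galaxy --star all
«one-way group homomorphism|…» and author:Shparlinski «communication complexity»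
(no relevant); lit search all «Bourgain Moebius correlation rank-one systems» (arXiv:1112.1032 =
ergodic rank-one maps, unrelated); lit frontier QuantumAdvantage --since 2024
(30 rows: QAC⁰ bounds arXiv:2512.14643, 2604.02793, magic hierarchy 2504.19966 — none on arithmetic
witnesses); ledger negatives (5 items, none related); BC4 exact? against
Mathlib + the tree's Möbius/Liouville files +
MobiusLadder/TwoSquaresLadder/ArithStatLadder/WeilTwice/RectangleFree: 4/4 fail.
Nearest prior art found: route-QuantumAdvantage-MobiusLadder (same witness λ, digit-input rungs
AC⁰/AC⁰[⊕]/TC⁰-open, stmt-1393); Babai–Nisan–Szegedy 1992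
doi:10.1016/0022-0000(92)90047-M and Chung–Tetali / Viola–Wigderson doi:10.4086/toc.2008.v004a007
(the sum-lift for the quadratic CHARACTER, an easy function, via Weil);  [refs: 10.1016/0022-0000(92, 10.4086/toc.2008.v004a007, 1112.1032, 2512.14643, 1103.4991, doi:10.1016/0022-0000, doi:10.4086/toc.2008.v004a007, Jukna2012, Green2012]

Barriers (technique_class: additive-lift, discrepancy, communication-rungs): - technique_class: additive-lift, discrepancy, communication-rungs
- Literature.Barriers.QuantumAdvantage.NaturalProofs: the rungs ARE natural (discrepancy / sign-rank
are constructive and large) but sit BELOW the barrier's class: rectangle rules, MAJ∘MAJ and THR∘MAJ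
host no pseudorandom functions (IP already defeats them), so Razborov–Rudich under HardPRGExist does
not quantify over these classes; the same fact is this ladder's ceiling (THR∘THR, TC⁰ depth ≥ 3
would need non-natural input) — declared in BC9, not evaded. The apex-type statement λ ∉ P/poly is
NOT an item here.
- Literature.Barriers.QuantumAdvantage.NaturalProofsNarrow: same placement — no item of this route
is a P/poly lower bound; the rung classes are strictly inside P/poly and below the PRG frontier.
- Literature.Barriers.QuantumAdvantage.QuantumNaturalProofs: not in scope (no BQP ⊄ P/poly or
explicit ∉ P/poly claim); the BQP-constructivity of discrepancy is irrelevant below the PRG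
frontier.
- Literature.Barriers.QuantumAdvantage.BQPRelativizationNarrow: the bridge BeyondRectangles → S
relativizes, admissibly, because the hypothesis is the hardness of ONE specific language (shape
(R2a) of the barrier inversion): it is false in every collapsing world, as the barrier demands; the
rung theorems are non-uniform restricted-model statements outside its scope.
SeparationPrerequisites-strength of the hypothesis is conceded (hypothesis-type, ranked last, never
staffed).
- Literature.Barriers.QuantumAdvantage.Algebriz

sub-problem: QuantumAdvantage · status: open · opened planner-plan-novel-QuantumAdvantage-QuantumAdva-e0108269-c-v2-g38-0 2026-08-17T15:19:34Z · rev 0 · ledger route-QuantumAdvantage-HankelLift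
GENERATED by the gate from the ledger (D-0016/17). Provers cite these decls: `theorem foo : Summit.QuantumAdvantage.QuantumAdvantage.Theses.HankelLift.<Decl> := …` in Summits/QuantumAdvantage/QuantumAdvantage/Theorems/<Name>.lean.
-/

namespace Summit.QuantumAdvantage.QuantumAdvantage.Theses.HankelLift

open scoped BigOperators Topology Manifold Classical MeasureTheory ProbabilityTheory Matrix InnerProductSpace ComplexConjugate ContinuousMap
open Filter Set Function TopologicalSpace MeasureTheory

attribute [summit_statement] _root_.QuantumAdvantage

open Literature.QuantumAdvantage

/-- item stmt-QuantumAdvantage-18439 · crux · rank 2 · closed · proved by Summit.QuantumAdvantage.QuantumAdvantage.Theorems.hankelDiscrepancy_proof (prover) · by planner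
why it might fail: Not in truth (Davenport for λ is a theorem); as a project: the major arcs need Siegel–Walfisz for λ twisted by e(a m/q) for ALL q ≤ (log N)^{50(C+4)} (tree has μ in APs; λ via λ = 1_□ ∗ μ) and the Green Prop. 4 exponent 50 forces large log-powers — L-sized bookkeeping.
sources: Davenport1937, MontgomeryVaughan2007, arXiv:1103.4991, doi:10.1016/0022-0000(92)90047-M
[crux] for every C, for all large n, every pair of sets S, T ⊆ [0,2^n) has |Σ_{x∈S} Σ_{y∈T}
λ(x+y+2)| ≤ 4^n / n^C (rectangle discrepancy of the Liouville Hankel pattern; Davenport uniform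
exponential-sum bound + Parseval). [difficulty: L] -/
@[route_item "route-QuantumAdvantage-HankelLift", crux]
def HankelDiscrepancy : Prop :=
  ∀ C : ℕ, ∀ᶠ n : ℕ in Filter.atTop, ∀ S T : Finset (Fin (2 ^ n)), |∑ x ∈ S, ∑ y ∈ T, ((ArithmeticFunction.liouville (x.val + y.val + 2) : ℤ) : ℝ)| ≤ (4 : ℝ) ^ n / (n : ℝ) ^ C

-- `HankelDiscrepancy` holds: proved by `Summit.QuantumAdvantage.QuantumAdvantage.Theorems.hankelDiscrepancy_proof` (its module imports this route file, so no `_holds` link can be stated here).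

/-- item stmt-QuantumAdvantage-18440 · crux · rank 3 · open · by planner
why it might fail: Fails iff some PPT agrees with λ(x+y+2) on ≥ 0.6 of uniform n-bit pairs for all large n (a 0.2-correlating feasible statistic; fully factorable inputs have density O((log n)²/n), smooth-part tests correlate ≪ e^{−c√n}); average-case, so stronger than worst-case λ ∉ BPP.
sources: Sarnak2010, Kalai2011, AroraBarak2009, arXiv:1103.4991
[crux] (hypothesis-type, never staffed for proof) for every probabilistic polynomial-time algorithm
A and infinitely many n there is a product-partition rule (a, b : [2^n] → [k], g : [k]² → {0,1}, k ≤
n²) such that A's average probability of outputting [λ(x+y+2) = −1] correctly over uniform (x,y) ∈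
[2^n]² is at most the rule's agreement fraction plus 1/10. [deps: HankelDiscrepancy] [difficulty:
open-problem] -/
@[route_item "route-QuantumAdvantage-HankelLift", crux]
def BeyondRectangles : Prop :=
  let enc : ℕ → ℕ → ℕ → List Bool := fun n x y => Literature.Computability.Complexity.boolPair (List.ofFn fun i : Fin n => Nat.testBit x i) (List.ofFn fun i : Fin n => Nat.testBit y i); let L : Language Bool := {w | ∃ n x y : ℕ, x < 2 ^ n ∧ y < 2 ^ n ∧ w = enc n x y ∧ ArithmeticFunction.liouville (x + y + 2) = -1}; ∀ A : Literature.Computability.Complexity.RandAlg (List Bool) Bool, A.IsPolyTime id Computability.encodeBool → ∃ᶠ n : ℕ in Filter.atTop, ∃ k : ℕ, k ≤ n ^ 2 ∧ ∃ (a b : Fin (2 ^ n) → Fin k) (g : Fin k → Fin k → Bool), (∑ p ∈ (Finset.univ : Finset (Fin (2 ^ n) × Fin (2 ^ n))), A.pr id (enc n p.1 p.2) {L.boolIndicator (enc n p.1 p.2)}) / ((Finset.univ : Finset (Fin (2 ^ n) × Fin (2 ^ n))).card : ℝ) ≤ (((Finset.univ.filter fun p : Fin (2 ^ n) × Fin (2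 ^ n) => g (a p.1) (b p.2) = decide (ArithmeticFunction.liouville (p.1.val + p.2.val + 2) = -1)).card : ℝ) / ((Finset.univ : Finset (Fin (2 ^ n) × Fin (2 ^ n))).card : ℝ)) + 1 / 10

/-- item stmt-QuantumAdvantage-18441 · support · rank 9 · closed · proved by Summit.QuantumAdvantage.QuantumAdvantage.Theorems.discToRules_proof (prover) · by planner
sources: Chazelle2000, doi:10.1016/0022-0000(93)90001-D, KushilevitzNisan1997
[support] HankelDiscrepancy implies: for all large n, every product-partition rule with k ≤ n²
labels a side agrees with [λ(x+y+2) = −1] on at most a 1/2 + 1/100 fraction of [2^n]² (sum the k²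
cell discrepancies with C = 5). [difficulty: provable-now] -/
@[route_item "route-QuantumAdvantage-HankelLift", crux]
def DiscToRules : Prop :=
  HankelDiscrepancy → ∀ᶠ n : ℕ in Filter.atTop, ∀ k : ℕ, k ≤ n ^ 2 → ∀ (a b : Fin (2 ^ n) → Fin k) (g : Fin k → Fin k → Bool), (((Finset.univ.filter fun p : Fin (2 ^ n) × Fin (2 ^ n) => g (a p.1) (b p.2) = decide (ArithmeticFunction.liouville (p.1.val + p.2.val + 2) = -1)).card : ℝ) / ((Finset.univ : Finset (Fin (2 ^ n) × Fin (2 ^ n))).card : ℝ)) ≤ 1 / 2 + 1 / 100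

-- `DiscToRules` holds: proved by `Summit.QuantumAdvantage.QuantumAdvantage.Theorems.discToRules_proof` (its module imports this route file, so no `_holds` link can be stated here).

/-- item stmt-QuantumAdvantage-18442 · support · rank 9 · open · by planner
sources: Shor1997, BernsteinVazirani1997, arXiv:1103.4991
[support] the lifted pair-language {boolPair(bits_n x, bits_n y) : x, y < 2^n, λ(x+y+2) = −1} is in
BQP (MobiusLadder.LiouvilleMemBQP, landed as Theorems/MobiusLadderLiouvilleMemBQP.lean, composed
with the linear-time map (x,y) ↦ x+y+2 and BQP's closure under polynomial-time many-one maps).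
[difficulty: M] -/
@[route_item "route-QuantumAdvantage-HankelLift", crux]
def LiouvilleSumMemBQP : Prop :=
  let enc : ℕ → ℕ → ℕ → List Bool := fun n x y => Literature.Computability.Complexity.boolPair (List.ofFn fun i : Fin n => Nat.testBit x i) (List.ofFn fun i : Fin n => Nat.testBit y i); let L : Language Bool := {w | ∃ n x y : ℕ, x < 2 ^ n ∧ y < 2 ^ n ∧ w = enc n x y ∧ ArithmeticFunction.liouville (x + y + 2) = -1}; L ∈ Literature.Computability.Cryptography.BQP

/-- item stmt-QuantumAdvantage-18443 · assembly · rank 1 · closed · proved by Summit.QuantumAdvantage.QuantumAdvantage.Theorems.hankelLift_assembly_proof (prover) · by planner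
sources: BernsteinVazirani1997, AroraBarak2009
[assembly] LiouvilleSumMemBQP → HankelDiscrepancy → DiscToRules → BeyondRectangles → the summit. -/
@[route_item "route-QuantumAdvantage-HankelLift"]
def Assembly : Prop :=
  LiouvilleSumMemBQP → HankelDiscrepancy → DiscToRules → BeyondRectangles → QuantumAdvantage

-- `Assembly` holds: proved by `Summit.QuantumAdvantage.QuantumAdvantage.Theorems.hankelLift_assembly_proof` (its module imports this route file, so no `_holds` link can be stated here).

/-! D-0027 §2.1 — DECIDING THEOREM (planner-authored via `route open/edit --closes-file`; by planner-plan-novel-QuantumAdvantage-QuantumAdva-e0108269-c-v 2026-08-17T15:19:34Z):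
its hypotheses are this route's items and its conclusion the sub-problem Statement (glue_lint), and it elaborates with this file. -/

@[closes "route-QuantumAdvantage-HankelLift"] theorem closes (h₁ : LiouvilleSumMemBQP) (h₂ : HankelDiscrepancy) (h₃ : DiscToRules)
    (h₄ : BeyondRectangles) : QuantumAdvantage := by
  refine ⟨_, h₁, fun hB => ?_⟩
  obtain ⟨A, hA, -, hcorr⟩ :=
    Literature.Computability.Complexity.exists_randAlg_error_le_of_mem_BPP_holds hB (1 / 200) (by norm_num)
  obtain ⟨n₀, hn₀⟩ := Filter.eventually_atTop.mp (h₃ h₂)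
  obtain ⟨n, hn, k, hk, a, b, g, hle⟩ := Filter.frequently_atTop.mp (h₄ A hA) n₀
  have hrule := hn₀ n hn k hk a b g
  have hcard : (0 : ℝ) < ((Finset.univ : Finset (Fin (2 ^ n) × Fin (2 ^ n))).card : ℝ) := by
    have h2 : 0 < 2 ^ n := Nat.two_pow_pos n
    have hne : (Finset.univ : Finset (Fin (2 ^ n) × Fin (2 ^ n))).Nonempty :=
      ⟨((⟨0, h2⟩ : Fin (2 ^ n)), (⟨0, h2⟩ : Fin (2 ^ n))), Finset.mem_univ _⟩
    exact_mod_cast Finset.card_pos.mpr hne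
  have key : ∀ (s R c : ℝ), 0 < c → c * (1 - 1 / 200) ≤ s → R / c ≤ 1 / 2 + 1 / 100 →
      s / c ≤ R / c + 1 / 10 → False := by
    intro s R c hc hs hR h
    have : 1 - 1 / 200 ≤ s / c := by rw [le_div_iff₀ hc]; linarith
    linarith
  refine key _ _ _ hcard ?_ hrule hle
  refine le_trans (le_of_eq ?_) (Finset.card_nsmul_le_sum _ _ (1 - 1 / 200 : ℝ) fun x _ => hcorr _)
  rw [nsmul_eq_mul]

end Summit.QuantumAdvantage.QuantumAdvantage.Theses.HankelLift
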